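import Mathlib.RingTheory.Ideal.KrullsHeightTheorem
import Mathlib.RingTheory.DedekindDomain.Basic
import HarnessLib

/-!
# Irreducibility of almost every fibre from irreducibility of the fibre of a hypersurface model

Topic `Literature/AlgebraicGeometry/Motives`; the fibre-comparison step of the elementary proof of
the two-point curve lemma (`Motives/CurveThroughTwoPoints`, `mumford_smoothCurve_through_two_points`;
Mumford, *Abelian Varieties*, §6). Setting: `R` a ring of dimension `≤ 1` (in the application the
relative algebraic closure `R'` of `K[t]`), `φ : B₀ → B'` an injective map of `R`-algebras which are
domains, `B'` noetherian (in the application `B₀ = R'[x, y] ≅ R'[X]/(F)` is the hypersurface model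
and `B'` the normalisation of the pencil), and `c ∈ B₀` a common denominator: `B' ⊆ B₀[1/c]`
(`∀ z, ∃ N, c^N z ∈ B₀`). For a maximal ideal `𝔞 ≠ 0` of `R` such that

* the fibre of the model is integral and does not lie in `{c = 0}`: `𝔞B₀` is prime and `c ∉ 𝔞B₀`
  (in the application: Noether specialisation of the absolutely irreducible `F`), and
* `𝔞` is not the image of a component of `{c = 0} ⊆ Spec B'`: no minimal prime of `cB'` contracts
  to `𝔞` (finitely many exclusions),

the fibre of `Spec B' → Spec R` over `𝔞` is IRREDUCIBLE: the radical of `𝔞B'` is the prime ideal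
`{z | ∃ N, c^N z ∈ 𝔞B₀}` (`isPrime_radical_map_of_goodFibre`). Proof: a minimal prime `𝔔` of `𝔞B'`
has height `≤ 1` (it is minimal over `rB'` for any `0 ≠ r ∈ 𝔞`, since `𝔔 ∩ R ⊇ 𝔞` is maximal and
`dim R ≤ 1`; Krull's principal ideal theorem), so `c ∈ 𝔔` would make `𝔔` a minimal prime of `cB'`
contracting to `𝔞`; hence `c ∉ 𝔔`, which forces `{z | ∃ N, c^N z ∈ 𝔞B₀} ⊆ 𝔔`, and the left side
is a prime containing `𝔞B'`.

Everything is proved; no named facts.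

## References

* D. Mumford, *Abelian Varieties* (1970), §6, Lemma. [MumfordAV1970]
-/

noncomputable section

namespace Literature.AlgebraicGeometry.Motives

namespace TwoPointPencil

variable {R B₀ B' : Type*} [CommRing R] [CommRing B₀] [CommRing B'] [Algebra R B₀] [Algebra R B']

/-- **Minimal primes of a maximal-ideal fibre over a one-dimensional base have height `≤ 1` and
contract to the maximal ideal.** `R` of dimension `≤ 1`, `𝔞 ≠ 0` maximal, `B'` noetherian,
`𝔔` a minimal prime of `𝔞B'`: then `𝔔 ∩ R = 𝔞` and `ht 𝔔 ≤ 1` (for `0 ≠ r ∈ 𝔞` a minimal prime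
`𝔔₀ ⊆ 𝔔` of `rB'` has `𝔔₀ ∩ R ∋ r` nonzero prime, hence maximal, hence `= 𝔞`, so `𝔔₀ ⊇ 𝔞B'` and
`𝔔₀ = 𝔔`; Krull). [folklore] -/
theorem comap_eq_and_height_le_one_of_mem_minimalPrimes_map [Ring.DimensionLEOne R]
    [IsNoetherianRing B'] {𝔞 : Ideal R} [𝔞.IsMaximal] (h𝔞 : 𝔞 ≠ ⊥) {𝔔 : Ideal B'}
    (h𝔔 : 𝔔 ∈ (𝔞.map (algebraMap R B')).minimalPrimes) :
    𝔔.comap (algebraMap R B') = 𝔞 ∧ 𝔔.height ≤ 1 := by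
  have h𝔔p : 𝔔.IsPrime := h𝔔.1.1
  have hI𝔔 : 𝔞.map (algebraMap R B') ≤ 𝔔 := h𝔔.1.2
  have hcomap : 𝔔.comap (algebraMap R B') = 𝔞 :=
    (Ideal.IsMaximal.eq_of_le ‹_› (Ideal.comap_ne_top _ h𝔔p.ne_top)
      (Ideal.map_le_iff_le_comap.mp hI𝔔)).symm
  refine ⟨hcomap, ?_⟩
  obtain ⟨r, hr𝔞, hr0⟩ := Submodule.exists_mem_ne_zero_of_ne_bot h𝔞
  have hr𝔔 : Ideal.span {algebraMap R B' r} ≤ 𝔔 := by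
    rw [Ideal.span_singleton_le_iff_mem]
    exact hI𝔔 (Ideal.mem_map_of_mem _ hr𝔞)
  obtain ⟨𝔔₀, h𝔔₀min, h𝔔₀le⟩ := Ideal.exists_minimalPrimes_le hr𝔔
  have h𝔔₀p : 𝔔₀.IsPrime := h𝔔₀min.1.1
  have hht₀ : 𝔔₀.height ≤ 1 :=
    Ideal.height_le_one_of_isPrincipal_of_mem_minimalPrimes _ _ h𝔔₀min
  have hne : 𝔔₀.comap (algebraMap R B') ≠ ⊥ := by
    intro h
    have hr : r ∈ 𝔔₀.comap (algebraMap R B') := by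
      rw [Ideal.mem_comap]
      exact h𝔔₀min.1.2 (Ideal.mem_span_singleton_self _)
    rw [h, Ideal.mem_bot] at hr
    exact hr0 hr
  have hmax : (𝔔₀.comap (algebraMap R B')).IsMaximal :=
    (Ideal.comap_isPrime (algebraMap R B') 𝔔₀).isMaximal hne
  have hcomap₀ : 𝔔₀.comap (algebraMap R B') = 𝔞 := by
    rw [← hcomap]
    exact hmax.eq_of_le (Ideal.comap_ne_top _ h𝔔p.ne_top) (Ideal.comap_mono h𝔔₀le)
  have h𝔔₀I : 𝔞.map (algebraMap R B') ≤ 𝔔₀ := Ideal.map_le_iff_le_comap.mpr hcomap₀.ge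
  have h𝔔le : 𝔔 ≤ 𝔔₀ := h𝔔.2 ⟨h𝔔₀p, h𝔔₀I⟩ h𝔔₀le
  rwa [le_antisymm h𝔔le h𝔔₀le]

/-- **Irreducibility of a good fibre** (fibre-comparison step of the elementary proof of Mumford's
two-point lemma). `R` of dimension `≤ 1`; `φ : B₀ ↪ B'` an injective map of `R`-algebras that are
domains, `B'` noetherian; `c ∈ B₀` with `B' ⊆ B₀[1/c]`; `𝔞 ≠ 0` a maximal ideal of `R` with `𝔞B₀`
prime, `c ∉ 𝔞B₀`, and no minimal prime of `cB'` contracting to `𝔞`. Then the radical of `𝔞B'` is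
prime — the fibre of `Spec B'` over `𝔞` is irreducible — and does not contain `c`; explicitly
`√(𝔞B') = {z | ∃ N, c^N z ∈ 𝔞B₀}`. [cite: MumfordAV1970, §6, Lemma (proof, fibre step, elementary
replacement of Bertini's theorem)] -/
theorem isPrime_radical_map_of_goodFibre [Ring.DimensionLEOne R] [IsDomain B₀] [IsDomain B']
    [IsNoetherianRing B'] (φ : B₀ →ₐ[R] B') (hφ : Function.Injective φ) {c : B₀} (hc : ∀ z : B', ∃ N : ℕ, ∃ v : B₀, φ c ^ N * z = φ v)
    {𝔞 : Ideal R} [𝔞.IsMaximal] (h𝔞 : 𝔞 ≠ ⊥) (hprime : (𝔞.map (algebraMap R B₀)).IsPrime)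
    (hcn : c ∉ 𝔞.map (algebraMap R B₀))
    (hgood : ∀ 𝔠 ∈ (Ideal.span {φ c}).minimalPrimes, 𝔠.comap (algebraMap R B') ≠ 𝔞) :
    (𝔞.map (algebraMap R B')).radical.IsPrime ∧ φ c ∉ (𝔞.map (algebraMap R B')).radical ∧
      ∀ z : B', z ∈ (𝔞.map (algebraMap R B')).radical ↔
        ∃ N : ℕ, ∃ w ∈ 𝔞.map (algebraMap R B₀), φ c ^ N * z = φ w := by
  set I : Ideal B' := 𝔞.map (algebraMap R B') with hI
  set I₀ : Ideal B₀ := 𝔞.map (algebraMap R B₀) with hI₀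
  have hc0 : φ c ≠ 0 := by
    intro h
    rw [← map_zero φ] at h
    exact hcn (hφ h ▸ zero_mem I₀)
  have hcpow : ∀ N : ℕ, c ^ N ∉ I₀ := fun N h => hcn (hprime.mem_of_pow_mem N h)
  -- the image of `I₀` lies in `I`
  have hI₀I : ∀ w ∈ I₀, φ w ∈ I := by
    intro w hw
    have : I₀ ≤ I.comap φ := by
      rw [hI₀, Ideal.map_le_iff_le_comap]
      intro r hr
      rw [Ideal.mem_comap, Ideal.mem_comap, AlgHom.commutes]
      exact Ideal.mem_map_of_mem _ hr
    exact this hw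
  -- Step A: `c` lies in no minimal prime of `I`
  have hA : ∀ 𝔔 ∈ I.minimalPrimes, φ c ∉ 𝔔 := by
    intro 𝔔 h𝔔 hc𝔔
    obtain ⟨hcomap, hht⟩ := comap_eq_and_height_le_one_of_mem_minimalPrimes_map h𝔞 h𝔔
    have h𝔔p : 𝔔.IsPrime := h𝔔.1.1
    obtain ⟨𝔠, h𝔠min, h𝔠le⟩ :=
      Ideal.exists_minimalPrimes_le ((Ideal.span_singleton_le_iff_mem 𝔔).mpr hc𝔔)
    have h𝔠p : 𝔠.IsPrime := h𝔠min.1.1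
    have h𝔠ne : 𝔠 ≠ ⊥ := by
      intro h
      have := h𝔠min.1.2 (Ideal.mem_span_singleton_self (φ c))
      rw [h, Ideal.mem_bot] at this
      exact hc0 this
    have h1𝔠 : 1 ≤ 𝔠.height := by
      rw [Order.one_le_iff_ne_zero, Ne, Ideal.height_eq_zero_iff_eq_bot]
      exact h𝔠ne
    have h𝔠eq : 𝔠 = 𝔔 := Ideal.eq_of_le_of_height_le 𝔠 h𝔠le (hht.trans h1𝔠)
    exact hgood 𝔠 h𝔠min (h𝔠eq ▸ hcomap)
  -- Step B: the saturation `𝔓 = {z | ∃ N, c^N z ∈ I₀}` is a prime containing `I`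
  let 𝔓 : Ideal B' :=
    { carrier := {z | ∃ N : ℕ, ∃ w ∈ I₀, φ c ^ N * z = φ w}
      zero_mem' := ⟨0, 0, zero_mem _, by simp⟩
      add_mem' := by
        rintro z₁ z₂ ⟨N₁, w₁, hw₁, h₁⟩ ⟨N₂, w₂, hw₂, h₂⟩
        refine ⟨N₁ + N₂, c ^ N₂ * w₁ + c ^ N₁ * w₂,
          add_mem (Ideal.mul_mem_left _ _ hw₁) (Ideal.mul_mem_left _ _ hw₂), ?_⟩
        rw [mul_add, map_add, map_mul, map_mul, map_pow, map_pow, ← h₁, ← h₂]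
        ring
      smul_mem' := by
        rintro b z ⟨N, w, hw, h⟩
        obtain ⟨M, v, hv⟩ := hc b
        refine ⟨M + N, v * w, Ideal.mul_mem_left _ _ hw, ?_⟩
        rw [smul_eq_mul, map_mul, ← hv, ← h]
        ring }
  have hmem𝔓 : ∀ z : B', z ∈ 𝔓 ↔ ∃ N : ℕ, ∃ w ∈ I₀, φ c ^ N * z = φ w := fun z => Iff.rfl
  have hI𝔓 : I ≤ 𝔓 := by
    rw [hI, Ideal.map_le_iff_le_comap]
    intro r hr
    rw [Ideal.mem_comap, hmem𝔓]
    exact ⟨0, algebraMap R B₀ r, Ideal.mem_map_of_mem _ hr, by simp⟩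
  have h𝔓c : ∀ N : ℕ, φ c ^ N ∉ 𝔓 := by
    rintro N ⟨M, w, hw, h⟩
    rw [← pow_add, ← map_pow] at h
    exact hcpow _ (hφ h ▸ hw)
  have h𝔓prime : 𝔓.IsPrime := by
    refine Ideal.isPrime_iff.mpr ⟨fun h => h𝔓c 0 (by rw [h]; trivial), ?_⟩
    rintro z₁ z₂ ⟨N, w, hw, h⟩
    obtain ⟨M₁, v₁, hv₁⟩ := hc z₁
    obtain ⟨M₂, v₂, hv₂⟩ := hc z₂
    have key : c ^ N * v₁ * v₂ = c ^ (M₁ + M₂) * w := by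
      apply hφ
      rw [map_mul, map_mul, map_pow, ← hv₁, ← hv₂, map_mul, map_pow, ← h]
      ring
    have hmem : c ^ N * v₁ * v₂ ∈ I₀ := key ▸ Ideal.mul_mem_left _ _ hw
    rcases hprime.mem_or_mem hmem with h₁ | h₂
    · rcases hprime.mem_or_mem h₁ with h₁ | h₁
      · exact absurd h₁ (hcpow N)
      · exact Or.inl ⟨M₁, v₁, h₁, hv₁⟩
    · exact Or.inr ⟨M₂, v₂, h₂, hv₂⟩
  -- Step C: `𝔓` lies below every minimal prime of `I`, hence equals each of them
  have h𝔓le : ∀ 𝔔 ∈ I.minimalPrimes, 𝔓 ≤ 𝔔 := by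
    rintro 𝔔 h𝔔 z ⟨N, w, hw, h⟩
    have h𝔔p : 𝔔.IsPrime := h𝔔.1.1
    have hz : φ c ^ N * z ∈ 𝔔 := h ▸ h𝔔.1.2 (hI₀I w hw)
    rcases h𝔔p.mem_or_mem hz with h₁ | h₂
    · exact absurd (h𝔔p.mem_of_pow_mem N h₁) (hA 𝔔 h𝔔)
    · exact h₂
  have hrad : I.radical = 𝔓 := by
    apply le_antisymm ((h𝔓prime.radical_le_iff).mpr hI𝔓)
    rw [Ideal.radical_eq_sInf]
    refine le_sInf ?_
    rintro J ⟨hIJ, hJ⟩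
    obtain ⟨𝔔, h𝔔, h𝔔J⟩ := @Ideal.exists_minimalPrimes_le _ _ I J hJ hIJ
    exact (h𝔓le 𝔔 h𝔔).trans h𝔔J
  refine ⟨hrad ▸ h𝔓prime, fun h => h𝔓c 1 ?_, fun z => by rw [hrad]; exact hmem𝔓 z⟩
  rw [pow_one]
  exact hrad ▸ h

end TwoPointPencil

end Literature.AlgebraicGeometry.Motives

end
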